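import Literature.MathematicalPhysics.QuantumFieldTheory.Balaban1983to89.B7Prop10General
import Literature.MathematicalPhysics.QuantumFieldTheory.Balaban1983to89.B7Eq214Flat

/-!
# `Balaban1983to89.B7Eq214General` — T. Bałaban, *Averaging operations for lattice gauge theories*, Commun. Math. Phys.
**98** (1985) 17–51 [Balaban1985Averaging], Sect. F (209)–(214) p. 50: the linearisation `Q′_j(u₁, λ) = (1/i) log ũ′ʲ =
(Q′_jλ) + C′_j(u₁, λ)`, `|C′_j| = O((α₃α₄ + α₄²)Lʲη)` AT A GENERAL (curved) BACKGROUND `U₀` — kernel form with explicit constants,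
by REDUCTION to the flat one-step kernel `B7Eq214Flat.eq211_flat` in the axial gauge and print's induction along the levels on
`B7Prop10General.prop10_general`

statement-level skeleton of published theorems with citation tags; proofs where landed; nothing here is a claim about the Yang–Mills mass gap

PDF held: `paper:balaban1985-cmp98-averaging` (journal page = PDF page + 16); render `…/1985-cmp98-averaging-p034-x2.png` (p. 50) and
`p014-x2.png` (p. 30), read as images by the unit.

CITATION HEADER (lean-in-tree rule).  Cell `lit-balaban` (HOME `run/shared/lean/pub/lit-balaban/`), unit `lit-balaban-r04`
(reader/typer of block B7, gen 3), an ANNOUNCED reader build (HOME/STATUS.md `TAKING B7.Eq213 @gen → B7Eq214General.lean`,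
2026-08-21) — a KERNEL PIECE for SKELETON rows `B7.Eq209` ((209)–(212)) and `B7.Eq213` ((213)–(214)); the ABSTRACT-carrier
citation statement of (213)–(214) is `B7Eq214.Eq214Printed`, the flat kernel (`U₀ = 1`) is `B7Eq214Flat.eq214_flat`.  Nothing of
the abstract carrier `B7.lean` is instantiated.

PRINT (p. 50, verbatim): "From (184), (187), we have for `v′ = e^{iλ}`
`ṽ′(y) = exp[iλ(y) + i Σ_{x∈B(y)} L^{−d}(R_{0,y}A)(Γ_{y,x}) + O(α₄Lα′₄) + O(L²(α′₃ + α′₄)α′₄)]`. (209) By definition of `A`,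
`A_b = (1/i) log e^{−iλ(b₋)}e^{iR_{0,b}λ(b₊)} = (1/i) log e^{−iλ(b₋)}e^{iλ(b₋)+i(D_{V₀}λ)(b)} = (D_{V₀}λ)(b) + O(α₄α′₄ + α′₄²)`, (210)
hence `(1/i) log ṽ′(y) = Σ_{x∈B(y)} L^{−d}(R_{0,y}λ)(x) + O(α₄Lα′₄ + L²α′₃α′₄ + L²α′₄²)`. (211) By (179) the function `Q′_j(u₁, λ)`
is a composition of one-step functions and from the above formula we can easily see that
`Q′_j(u₁, λ, y) = Σ_{x∈Bʲ(y)} L^{−jd}R(U₀(Γ^{(j)}_{y,x}))λ(x) + Σ_{l=0}^{j−1} O(C₅α₄2α₄Lˡη + α₃2α₄(Lˡη)² + 4α₄²(Lˡη)²)`, (212)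
hence `Q′_j(u₁, λ, y) = (Q′_jλ)(y) + C′_j(u₁, λ, y)`, (213) `|C′_j(u₁, λ, y)| = O((α₃α₄ + α₄²)Lʲη)`. (214)"  Here (p. 30 (77)/(78),
p. 45 (178)/(179)) `(R_{0,y}λ)(x) = R(V₀(Γ_{y,x}))λ(x)`, `R(X)Y = XYX⁻¹` (56), and `R(U₀(Γ^{(j+1)}_{x_{j+1},x})) =
R(Ū₀ʲ(Γ_{x_{j+1},x_j}))⋯R(Ū₀(Γ_{x₂,x₁}))R(U₀(Γ_{x₁,x}))` (77) composes the tree-contour transports of the averaged backgrounds `Ū₀ˡ`.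

WHAT THIS FILE PROVES (kernel, no `sorry`, standard axioms; all constants explicit).  Setting of `B7Prop9General`/`B7Prop10General`
(`𝔸` a complete normed `ℂ`-algebra with `‖1‖ = 1`; backgrounds with values in `U1 = {‖u‖ ≤ 1, ‖u⁻¹‖ ≤ 1}`; the one-step `ṽ′` at
`V₀` = `B7Prop9General.vtilG`; `ũ′ʲ` at `U₀` = `B7Prop10General.utilG`; `λ := log u′` sitewise, print's `i` absorbed).
* §1 `blockBd_rotClamp` — the localisation device of `B7Prop9General` completed for the BLOCK hypothesis (180d)/(167): the rotated
  site function clamped to the block `B(q)` (`B7Prop9General.rotClamp` in the axial gauge at `q`) satisfies the flat block hypothesis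
  `B7Prop9Flat.BlockBd` on ALL blocks of `ℤ^d` with `4β` when (180d) holds at the block `q` with `β ≤ ½` (the clamped function only
  takes block values, and `v₁(q)⁻¹(R_{0,q}v₁)(x)`, `x ∈ B(q)`, generate all its quotients).
* §2 `rlam` — print's main term of (211), `Σ_{x∈B(y)} L^{−d}(R_{0,y}λ)(x)` at `V₀`; **`eq211_general`** — **(209)–(211) AT A GENERAL
  BACKGROUND `V₀`**: for `V₀` (`U1`-valued, `‖V₀(∂p) − 1‖ ≤ α₀`) and `v′, v₁` with (180) (`SiteBd v′ α₄`, `CovBondBd V₀ v′ α′₄`,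
  `SiteBd v₁ α₃`, `CovBlockBd L V₀ v₁ β`) and explicit smallness, at every block corner `y = Lz`:
  `‖log ṽ′(y) − Σ_{x∈B(y)} L^{−d}(R_{0,y}λ)(x)‖ ≤ 448(d+1)L·α₄a′ + 1472(d+1)L·a′β`, `a′ = α′₄ + 4dL·α₀α₄` (print: `β = Lα′₃`).
* §3 `lamAvgG` — **the linear operator `(Q′_jλ)(y) = Σ_{x∈Bʲ(y)} L^{−jd}R(U₀(Γ^{(j)}_{y,x}))λ(x)` of (212)/(213) at `U₀`**, defined by
  the one-step recursion `(Q′_{j+1}λ)(z) = Σ_{x∈B(Lz)} L^{−d}R(Ū₀ʲ(Γ_{Lz,x}))(Q′_jλ)(x)` at the averaged backgrounds `Ū₀ʲ =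
  B7Prop2Explicit.avgIter L U₀ j` (the inductive definition (77) of the composed transports, in the coarse coordinates of (80)
  `B7Eq84Concrete.uavg`); `lamAvgG_one_left` (= `B7Eq214Flat.lamAvg` at `U₀ = 1`); **`eq212_general`**, **`eq214_general`** —
  **(212)–(214) AT A GENERAL BACKGROUND**: under the hypotheses of `B7Prop10General.prop10_general` (the level hypotheses `Ū₀ʲ ∈ U1`,
  `‖Ū₀ʲ(∂p) − 1‖ ≤ 2α₀(Lʲη)²`, (176) `SiteBd u′ α₄`, (177) `CovBondBd U₀ u′ (α₄η)`, (166)–(167) `u₁ ∈ Λ_k(U₀, α₃)`, `L ≥ 2`, `Lᵏη ≤ 1`,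
  its explicit smallness) plus `200α₃ ≤ 1`, `50C₆α₄ ≤ 1`, `8dC₆Lα₀ ≤ 1`: for all `j ≤ k` and all `y`,
  `‖log ũ′ʲ(y) − (Q′_jλ)(y)‖ ≤ C′_gen(α₃α₄ + α₄²)Lʲη`, `C′_gen = Cgen d = 8832(d+1)C₆` (`C₆ = C₅ + 1 = 2 + 256(d+1)`,
  `B7Prop10General.C6`); **`eq214_general_of52`** — the same with the level hypotheses DISCHARGED from (52) by Proposition 2
  (`B7Prop10General.levels_of52`), `η = L^{−k}`, for `U₀` with values in an average-closed subgroup `G ⊂ U1` (e.g. the unitary group).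
  **`eq214_general_of207`** (v1.1) — the same in print's datum `λ` under (207) (`‖R(U_{0,b})λ(b₊) − λ(b₋)‖ < α₄η`,
  `‖λ(x)‖ < α₄`; `u′ = e^{λ}`): (207) ⇒ (176)/(177) with `4α₄` by `B7Eq214.ineq176_of_207`/`ineq177_of_207`, constant `16C′_gen`.
THE PROOF (print's, p. 50, by reduction for the one step).  (211): in the axial gauge `w = V₀(Γ_{y,·})` at the corner `y` the twisted
averages (78) of `v′v₁` and `v₁` are the FLAT averages of the rotated functions `R(w)v′`, `R(w)v₁` clamped to the block
(`B7Prop9General.R0avg_eq_savg_rotClamp`, `rotClamp_mul`), so `ṽ′(y)` IS the flat one-step object `B7Prop9Flat.vtil` of the rotated data;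
the flat hypotheses transfer (`siteBd_rotClamp`, `bondBd_rotClamp` with the thin axial loops `≤ dLα₀` of `B7Prop1Explicit.axial_bond_bound`,
and §1 for the block hypothesis), and `B7Eq214Flat.eq211_flat` applies verbatim; its main term `Σ_r L^{−d} log(R(w(x))v′(x))` is print's
`Σ L^{−d}(R_{0,y}λ)(x)` because `log` commutes with rotations (`B7Eq170Flat.mlog_cj`, (57)).  (212)–(214): print's induction over the
levels ("By (179) the function `Q′_j(u₁, λ)` is a composition of one-step functions"): `ũ′^{j+1}(z) = ṽ′(Lz)` for the one step at `Ū₀ʲ` with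
`v′ = ũ′ʲ`, `v₁ = ū₁ʲ` (`B7Prop10General.utilG_succ`), the level constants from `prop10_general` ((204) `≤ C₆α₄`, (203) `≤ 2α₄Lʲη`,
(166)/(167) for `ū₁ʲ`, "`α₀` replaced by `2α₀(Lʲη)²`"), the step = `eq211_general`, and the rotated block mean does not increase the sup
norm of the accumulated error (rotations by `U1` elements are contractions); level sum `Σ_{l<j} L^{l+1}η ≤ 2Lʲη` (`B7.sum_pow_succ_le`).
READINGS (recorded; none is an objection to print).  (a) `U1`-VALUED BACKGROUNDS and the BANACH reading of `|·|` as in the lineage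
(`B7Prop9Flat` (b), `B7Prop9General` (a)).  (b) CONSTANTS: print's `O`-constants of (211)/(214) are unstated; here `C′_gen = 8832(d+1)C₆`
depends on `d` only; the one-step bound carries the `α₀`-terms `4dL·α₀α₄` inside `a′` (absent from print's (211), whose derivation only meets
covariant bond variables along `Γ_{y,x}` — the price of the flat kernel's global bond hypothesis, cf. `B7Prop9General` READING (b)); along
the levels they are absorbed into the `α₄²`-term under `8dC₆Lα₀ ≤ 1`, so that (214) keeps print's shape `O((α₃α₄ + α₄²)Lʲη)` exactly; no
`L²α′₄²`-term is needed ((210) is bilinear in this reading, `B7Eq214Flat.eq210`).  (c) SMALLNESS explicit (`c₆ = c₆(d, L)`, print: "`α₄`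
sufficiently small", "`α₀, α₃, α₄ ≦ c₆`"): that of `B7Prop10General.prop10_general` plus `200α₃ ≤ 1`, `50C₆α₄ ≤ 1`, `8dC₆Lα₀ ≤ 1`.
(d) LATTICE conventions of `B7Eq167Flat`/`B7Prop9Flat` (all of `ℤ^d` for `Ω`, blocks `B(Lz) = Lz + [0,L)^d`, tree contours
`B7Prop1Explicit.treeWord`; `≤` for `<`); `λ = log u′` (the (207)-form with `λ` as the datum is `B7Eq214FlatQprime` at `U₀ = 1`).
(e) The operator `Q′_j` over the abstract `Blocking` carrier is `B7Eq78Linearization.QprimeIter` (B9 (3.19)); `lamAvgG` is its concrete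
instance written directly on `ℤ^d` by the recursion (77)/(80) — the closed form over `Bʲ(y)` is not transcribed (at `U₀ = 1`:
`B7Eq214FlatQprime.lamAvg_eq_sum_blockSites`).  NOT CLAIMED: print's unstated absolute constants; (213)–(214) for `𝐆ᶜ`-valued
(non-unitary) backgrounds (Prop. 7's regime).
DECLARATIONS: 3 definitions (`rlam lamAvgG Cgen`), the rest theorems (private [folklore] helpers on `B7Prop9General.clamp`); imports
`B7Prop10General`, `B7Eq214Flat`; REUSED BY NAME: `B7Eq214Flat.eq211_flat`, `B7Prop9General.rotClamp, clamp, clampZ, boxTop,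
siteBd_rotClamp, bondBd_rotClamp, rotClamp_axial_block, R0avg_eq_savg_rotClamp, rotClamp_mul, vtilG, vtilG_apply, CovBondBd, CovBlockBd`,
`B7Prop10General.utilG, utilG_succ, prop10_general, levels_of52, rhs203G_le, rhs204G_le, C6, C4G`, `B7Prop9Flat.SiteBd, BondBd, BlockBd,
vtil_apply, C5'`, `B7Prop10Flat.C5, one_le_C5, siteBd_mono, bondBd_mono`, `B7Prop8Flat.pow_eta_le`, `B7Eq167Flat.InLambda, Cond167`,
`B7Eq170Flat.bmean, bmean_cj, norm_bmean_le, mlog_cj, cj`, `B7Eq99Concrete.R0fun, R0fun_add`, `B7Eq84Concrete.uavg`,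
`B7Prop1Explicit.axialFn, axialFn_mem, axial_bond_bound, hol, hol_mem, treeWord, boxVec, l1, U1`, `B7Prop2Explicit.avgIter, AvgClosed,
C0, c2', pdev`, `B7Eq92Concrete.Rc, avgIter_one`, `B8Ineq130.hol_one`, `B7.sum_pow_succ_le`, `MatrixLog.mlog`.
Unit `lit-balaban-r04` (gen 3), 2026-08-21.  v1.1 (APPEND-ONLY, same unit): + `eq214_general_of207`; v1 declarations byte-identical.

[cite: Balaban1985Averaging, (209)–(214) p.50, (207)–(208) p.50, Proposition 10 p.50, (201)–(206) p.49, (176)–(180) pp.45–46,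
(77)–(80) p.30, (56)–(57) p.27]
-/

noncomputable section

open NormedSpace Finset

namespace Literature.MathematicalPhysics.QuantumFieldTheory.Balaban1983to89.B7Eq214General

open B7Prop1Explicit B7Prop2Explicit MatrixLog B7Eq92Concrete B7Eq99Concrete B7Eq84Concrete B7Eq167Flat B7Eq170Flat B7Prop8Flat
  B7Prop9Flat B7Prop9General B7Prop10General B7Eq214Flat
open B7Prop10Flat (C5 one_le_C5 siteBd_mono bondBd_mono C5'_nonneg)
open B7Prop6Flat (norm_units_inv_sub_one_le)

-- `Site` alone would resolve to the torus sites of `Setup.lean`; re-export the `ℤ^d` sites of `B7Prop1Explicit`.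
export B7Prop1Explicit (Site)

variable {d : ℕ}

/-! ## §1 The clamped rotated function and the flat block hypothesis (180d)/(167) -/

section Clamp

/-- `clampZ_of_mem'`: inside the interval the clamp is the identity. [folklore] -/
private theorem clampZ_of_mem' {lo up t : ℤ} (h1 : lo ≤ t) (h2 : t ≤ up) : clampZ lo up t = t := by
  simp only [clampZ, max_def, min_def]; split_ifs <;> omega

/-- `clampZ_mem'`: the clamp lands in the (nonempty) interval. [folklore] -/
private theorem clampZ_mem' {lo up : ℤ} (h : lo ≤ up) (t : ℤ) : lo ≤ clampZ lo up t ∧ clampZ lo up t ≤ up := by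
  simp only [clampZ, max_def, min_def]; split_ifs <;> omega

/-- `clamp_block`: the clamp into the block box `[q, q + (L − 1)]^d` fixes the block points `q + r`, `r ∈ [0, L)^d`. [folklore] -/
private theorem clamp_block {L : ℕ} (q : Site d) (r : Fin d → Fin L) :
    clamp q (q + boxTop d L) (q + boxVec L r) = q + boxVec L r := by
  funext i
  have := (r i).isLt
  simp only [clamp, Pi.add_apply, boxVec, boxTop]
  exact clampZ_of_mem' (by omega) (by omega)

/-- `exists_boxVec_of_clamp`: every clamped point is a block point `q + r`, `r ∈ [0, L)^d` (`L ≥ 1`). [folklore] -/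
private theorem exists_boxVec_of_clamp {L : ℕ} (hL : 1 ≤ L) (q x : Site d) :
    ∃ r : Fin d → Fin L, clamp q (q + boxTop d L) x = q + boxVec L r := by
  have hmem : ∀ i, q i ≤ clamp q (q + boxTop d L) x i ∧ clamp q (q + boxTop d L) x i ≤ q i + ((L : ℤ) - 1) := by
    intro i
    have := clampZ_mem' (lo := q i) (up := q i + ((L : ℤ) - 1)) (by omega) (x i)
    simpa only [clamp, Pi.add_apply, boxTop] using this
  refine ⟨fun i => ⟨(clamp q (q + boxTop d L) x i - q i).toNat, ?_⟩, ?_⟩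
  · have := hmem i; omega
  · funext i
    have := hmem i
    simp only [Pi.add_apply, boxVec]
    omega

/-- `l1_le_of_box`: a point of the block box is within `ℓ¹` distance `dL` of the corner. [folklore] -/
private theorem l1_le_of_box {L : ℕ} {q p : Site d} (h : ∀ i, q i ≤ p i ∧ p i ≤ (q + boxTop d L) i) :
    (l1 (p - q) : ℝ) ≤ d * L := by
  have h' : ∀ i, ((p - q) i).natAbs ≤ L := fun i => by
    have := h i; simp only [Pi.add_apply, boxTop] at this; simp only [Pi.sub_apply]; omega
  have h1 : l1 (p - q) ≤ d * L := by
    unfold l1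
    calc ∑ κ, ((p - q) κ).natAbs ≤ ∑ _κ : Fin d, L := Finset.sum_le_sum fun κ _ => h' κ
      _ = d * L := by simp
  exact_mod_cast h1

variable {𝔸 : Type*} [NormedRing 𝔸] [NormOneClass 𝔸] [NormedAlgebra ℂ 𝔸] [CompleteSpace 𝔸]

omit [NormOneClass 𝔸] [NormedAlgebra ℂ 𝔸] [CompleteSpace 𝔸] in
/-- `rotClamp_clamp`: the clamped rotated function (`B7Prop9General.rotClamp`) only takes its block values,
`(R(w)v)^{cl}(x) = (R(w)v)^{cl}(x̂)`, `x̂` the clamped point. [cite: Balaban1985Averaging, p.27 (display after (59))] -/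
private theorem rotClamp_clamp {L : ℕ} (hL : 1 ≤ L) (w : Site d → 𝔸ˣ) (q : Site d) (v : Site d → 𝔸ˣ) (x : Site d) :
    rotClamp w q (q + boxTop d L) v x = rotClamp w q (q + boxTop d L) v (clamp q (q + boxTop d L) x) := by
  obtain ⟨r, hr⟩ := exists_boxVec_of_clamp hL q x
  show Rc (w (clamp q (q + boxTop d L) x)) (v (clamp q (q + boxTop d L) x)) =
    Rc (w (clamp q (q + boxTop d L) (clamp q (q + boxTop d L) x))) (v (clamp q (q + boxTop d L) (clamp q (q + boxTop d L) x)))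
  rw [hr, clamp_block]

omit [NormOneClass 𝔸] [NormedAlgebra ℂ 𝔸] [CompleteSpace 𝔸] in
/-- `rotClamp_block`: at the block points the clamped rotated function is the rotated function,
`(R(w)v)^{cl}(q + r) = R(w(q + r))v(q + r)`. [cite: Balaban1985Averaging, p.27 (display after (59))] -/
private theorem rotClamp_block {L : ℕ} (w : Site d → 𝔸ˣ) (q : Site d) (v : Site d → 𝔸ˣ) (r : Fin d → Fin L) :
    rotClamp w q (q + boxTop d L) v (q + boxVec L r) = Rc (w (q + boxVec L r)) (v (q + boxVec L r)) := by
  show Rc (w (clamp q (q + boxTop d L) (q + boxVec L r))) (v (clamp q (q + boxTop d L) (q + boxVec L r))) = _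
  rw [clamp_block]

omit [NormOneClass 𝔸] [NormedAlgebra ℂ 𝔸] [CompleteSpace 𝔸] in
/-- **(180d)/(167) transfers to the rotated data, on ALL blocks.**  If the block quantities of (180d) at the corner `q`,
`v(q)⁻¹(R_{0,q}v)(x) = v(q)⁻¹R(V₀(Γ_{q,x}))v(x)`, `x ∈ B(q)` (print p. 46: "`|v₁⁻¹(y)(R₀v₁)(x) − 1| < Lα′₃, x ∈ B(y)`"), are within
`β ≤ ½` of `1`, then the rotated function in the axial gauge at `q`, clamped to `B(q)` (`B7Prop9General.rotClamp`), satisfies the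
FLAT block hypothesis `B7Prop9Flat.BlockBd` on every block of `ℤ^d` with `4β`: all its values are block values `W(x̂)`, and
`W(x̂)⁻¹W(x̂′) = (W(q)⁻¹W(x̂))⁻¹(W(q)⁻¹W(x̂′))` with `W(q)⁻¹W(x̂) = v(q)⁻¹(R_{0,q}v)(x̂)` (`B7Prop9General.rotClamp_axial_block`);
`‖X⁻¹Y − 1‖ ≤ (1 + 2β)(1 + β) − 1 ≤ 4β`.  (The device completing `B7Prop9General.bondBd_rotClamp`/`siteBd_rotClamp` for the third
hypothesis of the flat one-step kernels.) [cite: Balaban1985Averaging, (180) p.46, (167) p.44, p.27 (display after (59))] -/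
theorem blockBd_rotClamp {L : ℕ} (hL : 1 ≤ L) (V₀ : Site d → Fin d → 𝔸ˣ) {v : Site d → 𝔸ˣ} {β : ℝ} (q : Site d)
    (hq : ∀ r : Fin d → Fin L, ‖((((v q)⁻¹ * R0fun V₀ q v (q + boxVec L r) : 𝔸ˣ)) : 𝔸) - 1‖ ≤ β) (hβ : β ≤ 1 / 2) :
    BlockBd L (rotClamp (axialFn V₀ q) q (q + boxTop d L) v) (4 * β) := by
  have hβ0 : 0 ≤ β := (norm_nonneg _).trans (hq fun _ => ⟨0, hL⟩)
  -- every quotient from the corner is a (180d) quantity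
  have hquot : ∀ x : Site d, ‖((((rotClamp (axialFn V₀ q) q (q + boxTop d L) v q)⁻¹ *
      rotClamp (axialFn V₀ q) q (q + boxTop d L) v x : 𝔸ˣ)) : 𝔸) - 1‖ ≤ β := by
    intro x
    obtain ⟨r, hr⟩ := exists_boxVec_of_clamp hL q x
    rw [rotClamp_clamp hL (axialFn V₀ q) q v x, hr, rotClamp_axial_block hL]
    exact hq r
  intro z r
  set W : Site d → 𝔸ˣ := rotClamp (axialFn V₀ q) q (q + boxTop d L) v with hW
  set X : 𝔸ˣ := (W q)⁻¹ * W ((L : ℤ) • z) with hX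
  set Y : 𝔸ˣ := (W q)⁻¹ * W ((L : ℤ) • z + boxVec L r) with hY
  have hid : (W ((L : ℤ) • z))⁻¹ * W ((L : ℤ) • z + boxVec L r) = X⁻¹ * Y := by rw [hX, hY]; group
  have hX1 : ‖(X : 𝔸) - 1‖ ≤ β := hquot _
  have hY1 : ‖(Y : 𝔸) - 1‖ ≤ β := hquot _
  have hXi : ‖((X⁻¹ : 𝔸ˣ) : 𝔸) - 1‖ ≤ 2 * β :=
    (norm_units_inv_sub_one_le X (hX1.trans hβ)).trans (by linarith)
  rw [hid, Units.val_mul]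
  have h1 := B7Prop6Bound.mul_sub_one_norm_le (((X⁻¹ : 𝔸ˣ)) : 𝔸) (Y : 𝔸)
  have hA0 := norm_nonneg ((((X⁻¹ : 𝔸ˣ)) : 𝔸) - 1)
  have hB0 := norm_nonneg ((Y : 𝔸) - 1)
  nlinarith

end Clamp

/-! ## §2 (209)–(211): the one-step linearisation at a general background `V₀` -/

section OneStep

variable {𝔸 : Type*} [NormedRing 𝔸] [NormOneClass 𝔸] [NormedAlgebra ℂ 𝔸] [CompleteSpace 𝔸]

omit [NormOneClass 𝔸] [CompleteSpace 𝔸] in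
/-- **The main term of (211)**, "`Σ_{x∈B(y)} L^{−d}(R_{0,y}λ)(x)`": the block mean of the rotated `𝔤`-valued site function
`(R_{0,y}f)(x) = R(V₀(Γ_{y,x}))f(x)` (p. 27, display after (59); `x = y + r`, `r ∈ [0, L)^d`, `Γ_{y,x} = treeWord r` from `y`,
`R(X)Y = XYX⁻¹` = `B7Eq170Flat.cj`) — the one-step linear operator `(Q′f)(y)` of (211)–(213) at the background `V₀` (p. 28:
"`(Q′₀λ)(y) = Σ_{x∈B(y)} L^{−d}(R_{0,y}λ)(x)`", cf. `B7Eq61Linearization.Qp0` over an abstract transport).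
[cite: Balaban1985Averaging, (211) p.50, p.28, (78) p.30] -/
def rlam (L : ℕ) (V₀ : Site d → Fin d → 𝔸ˣ) (f : Site d → 𝔸) (y : Site d) : 𝔸 :=
  bmean L (fun r => cj (hol V₀ y (treeWord (boxVec L r))) (f (y + boxVec L r)))

omit [NormOneClass 𝔸] [CompleteSpace 𝔸] in
/-- `rlam_apply`: unfolding. [cite: Balaban1985Averaging, (211) p.50] -/
theorem rlam_apply (L : ℕ) (V₀ : Site d → Fin d → 𝔸ˣ) (f : Site d → 𝔸) (y : Site d) :
    rlam L V₀ f y = bmean L (fun r => cj (hol V₀ y (treeWord (boxVec L r))) (f (y + boxVec L r))) := rfl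

omit [NormOneClass 𝔸] [CompleteSpace 𝔸] in
/-- `rlam_one_left`: at `V₀ = 1` the rotations are trivial and `(Q′f)(y) = Σ_{x∈B(y)} L^{−d}f(x)` is the plain block mean
(the one step of `B7Eq214Flat.lamAvg`). [cite: Balaban1985Averaging, (211)–(212) p.50] -/
theorem rlam_one_left (L : ℕ) (f : Site d → 𝔸) (y : Site d) :
    rlam L (1 : Site d → Fin d → 𝔸ˣ) f y = bmean L (fun r => f (y + boxVec L r)) := by
  simp only [rlam, B8Ineq130.hol_one, cj_apply, Units.val_one, inv_one, one_mul, mul_one]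

omit [NormOneClass 𝔸] [CompleteSpace 𝔸] in
/-- `rlam_sub`: `Q′` is additive (linear), `Q′f − Q′g = Q′(f − g)`. [cite: Balaban1985Averaging, (211)–(213) p.50] -/
theorem rlam_sub (L : ℕ) (V₀ : Site d → Fin d → 𝔸ˣ) (f g : Site d → 𝔸) (y : Site d) :
    rlam L V₀ f y - rlam L V₀ g y = rlam L V₀ (fun x => f x - g x) y := by
  simp only [rlam, bmean_apply, cj_apply, mul_sub, sub_mul, smul_sub, Finset.sum_sub_distrib]

omit [NormedAlgebra ℂ 𝔸] [CompleteSpace 𝔸] in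
/-- `‖R(w)X‖ ≤ ‖X‖` for `w ∈ U1` (print: `R(w)` is an isometry for unitary `w`). [folklore] -/
private theorem norm_cj_le_of_mem {w : 𝔸ˣ} (hw : w ∈ U1 𝔸) (X : 𝔸) : ‖cj w X‖ ≤ ‖X‖ := by
  obtain ⟨h1, h2⟩ := mem_U1.mp hw
  rw [cj_apply]
  calc _ ≤ ‖(w : 𝔸)‖ * ‖X‖ * ‖((w⁻¹ : 𝔸ˣ) : 𝔸)‖ :=
        (norm_mul_le _ _).trans (mul_le_mul_of_nonneg_right (norm_mul_le _ _) (norm_nonneg _))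
    _ ≤ 1 * ‖X‖ * 1 := mul_le_mul (mul_le_mul_of_nonneg_right h1 (norm_nonneg X)) h2 (norm_nonneg _) (by positivity)
    _ = ‖X‖ := by ring

omit [CompleteSpace 𝔸] in
/-- `norm_rlam_le`: the rotated block mean does not increase the sup norm (rotations by `U1`-valued transporters are
contractions, the weights `L^{−d}` sum to one). [cite: Balaban1985Averaging, (211)–(212) p.50, (78) p.30] -/
theorem norm_rlam_le {L : ℕ} (hL : 1 ≤ L) {V₀ : Site d → Fin d → 𝔸ˣ} (hV : ∀ x κ, V₀ x κ ∈ U1 𝔸) {f : Site d → 𝔸}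
    {M : ℝ} (hf : ∀ x, ‖f x‖ ≤ M) (y : Site d) : ‖rlam L V₀ f y‖ ≤ M :=
  norm_bmean_le hL fun _ => (norm_cj_le_of_mem (hol_mem hV _ _) _).trans (hf _)

/-- **(209)–(211) AT A GENERAL BACKGROUND `V₀`, kernel form with explicit constants.**  Print (p. 50): "From (184), (187), we have
for `v′ = e^{iλ}` `ṽ′(y) = exp[iλ(y) + iΣ_{x∈B(y)}L^{−d}(R_{0,y}A)(Γ_{y,x}) + O(α₄Lα′₄) + O(L²(α′₃ + α′₄)α′₄)]`. (209) … hence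
`(1/i) log ṽ′(y) = Σ_{x∈B(y)} L^{−d}(R_{0,y}λ)(x) + O(α₄Lα′₄ + L²α′₃α′₄ + L²α′₄²)`. (211)" — `ṽ′ = \overline{R₀v′v₁}(\overline{R₀v₁})⁻¹`
the one step (179) at `V₀` (`B7Prop9General.vtilG`), `λ = (1/i) log v′`, under (180) p. 46.
HERE: `V₀` with values in `U1` (print: `G ⊂ U(N)`), `‖V₀(∂p) − 1‖ ≤ α₀` on all unit plaquettes, `v′, v₁` with (180a)
`‖v′ − 1‖ ≤ α₄ ≤ 1/50`, (180b) `CovBondBd V₀ v′ α′₄`, (180c) `‖v₁ − 1‖ ≤ α₃ ≤ 1/5`, (180d) `CovBlockBd L V₀ v₁ β` with `200β ≤ 1` (print: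
`β = Lα′₃`), and the smallness `10³(d+1)L·a′ ≤ 1`, `a′ := α′₄ + 4dL·α₀α₄`; then at every block corner `y = Lz`, with `λ = log v′`:
`‖log ṽ′(y) − Σ_{x∈B(y)} L^{−d}(R_{0,y}λ)(x)‖ ≤ 448(d+1)L·α₄a′ + 368(d+1)L·a′·(4β)`.
PROOF = REDUCTION TO `B7Eq214Flat.eq211_flat`: in the axial gauge `w = V₀(Γ_{y,·})` (`B7Prop1Explicit.axialFn`) the twisted averages
(78) are the flat averages of the rotated data clamped to the block (`B7Prop9General.R0avg_eq_savg_rotClamp`, `rotClamp_mul`), so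
`ṽ′(y)` is the flat `B7Prop9Flat.vtil` of `R(w)v′`, `R(w)v₁`; the flat (180) transfer (`siteBd_rotClamp`; `bondBd_rotClamp` with the thin
axial loops `≤ dLα₀`, `B7Prop1Explicit.axial_bond_bound`; `blockBd_rotClamp`); and `log R(w(x))v′(x) = R(w(x)) log v′(x) =
(R_{0,y}λ)(x)` (`B7Eq170Flat.mlog_cj`, (57)) identifies the flat main term with print's.  READING: print's (211) carries no `α₀`-term
(its derivation only meets covariant bond variables along `Γ_{y,x}`); the `4dL·α₀α₄` inside `a′` is the price of the flat kernel's
global bond hypothesis (cf. `B7Prop9General` READING (b)); no `L²α′₄²`-term is needed ((210) bilinear, `B7Eq214Flat.eq210`).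
[cite: Balaban1985Averaging, (209)–(211) p.50, (180)–(184) p.46, (187) p.47, (78) p.30, (57) p.27] -/
theorem eq211_general {L : ℕ} (hL : 1 ≤ L) {V₀ : Site d → Fin d → 𝔸ˣ} (hV : ∀ x κ, V₀ x κ ∈ U1 𝔸)
    {α₀ : ℝ} (hα₀ : 0 ≤ α₀)
    (h44 : ∀ (x : Site d) (κ μ : Fin d), κ ≠ μ → ‖((hol V₀ x (plaqWord κ μ) : 𝔸ˣ) : 𝔸) - 1‖ ≤ α₀)
    {v' v₁ : Site d → 𝔸ˣ} {α₃ α₄ α₄' β : ℝ}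
    (h4a : SiteBd v' α₄) (h4b : CovBondBd V₀ v' α₄') (h3c : SiteBd v₁ α₃) (h3d : CovBlockBd L V₀ v₁ β)
    (hα₄ : α₄ ≤ 1 / 50) (hα₄' : 0 ≤ α₄') (hα₃ : α₃ ≤ 1 / 5) (hβ : 200 * β ≤ 1)
    (hs : 1000 * ((d : ℝ) + 1) * L * (α₄' + 4 * (d * L * α₀) * α₄) ≤ 1) (z : Site d) :
    ‖mlog ((vtilG L V₀ v' v₁ ((L : ℤ) • z) : 𝔸ˣ) : 𝔸) - rlam L V₀ (fun x => mlog ((v' x : 𝔸ˣ) : 𝔸)) ((L : ℤ) • z)‖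
      ≤ 448 * ((d : ℝ) + 1) * L * α₄ * (α₄' + 4 * (d * L * α₀) * α₄) +
        368 * ((d : ℝ) + 1) * L * (α₄' + 4 * (d * L * α₀) * α₄) * (4 * β) := by
  set q : Site d := (L : ℤ) • z with hq
  set w : Site d → 𝔸ˣ := axialFn V₀ q with hwdef
  set W' : Site d → 𝔸ˣ := rotClamp w q (q + boxTop d L) v' with hW'
  set W₁ : Site d → 𝔸ˣ := rotClamp w q (q + boxTop d L) v₁ with hW₁
  set a' : ℝ := α₄' + 4 * (d * L * α₀) * α₄ with ha'
  have hα₄0 : 0 ≤ α₄ := (norm_nonneg _).trans (h4a 0)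
  have hw : ∀ x, w x ∈ U1 𝔸 := fun x => axialFn_mem hV q x
  have hbox : ∀ i, q i ≤ (q + boxTop d L) i := fun i => by simp only [Pi.add_apply, boxTop]; omega
  -- the flat hypotheses (180) for the rotated data
  have hG : ∀ (p : Site d) (κ : Fin d), (∀ i, q i ≤ p i ∧ p i ≤ (q + boxTop d L) i) →
      (∀ i, q i ≤ (p + e κ) i ∧ (p + e κ) i ≤ (q + boxTop d L) i) →
      ‖((gaugeAct w V₀ p κ : 𝔸ˣ) : 𝔸) - 1‖ ≤ d * L * α₀ := by
    intro p κ hp _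
    refine (axial_bond_bound V₀ hV q h44 hα₀ p κ).trans ?_
    exact mul_le_mul_of_nonneg_right (l1_le_of_box hp) hα₀
  have hg0 : 0 ≤ (d : ℝ) * L * α₀ := by positivity
  have h4bW : BondBd W' a' := bondBd_rotClamp hbox hw hV hg0 hG h4a (hα₄.trans (by norm_num)) h4b hα₄'
  have h4aW : SiteBd W' α₄ := siteBd_rotClamp hw _ _ h4a
  have h3cW : SiteBd W₁ α₃ := siteBd_rotClamp hw _ _ h3c
  have hβq : ∀ r : Fin d → Fin L, ‖((((v₁ q)⁻¹ * R0fun V₀ q v₁ (q + boxVec L r) : 𝔸ˣ)) : 𝔸) - 1‖ ≤ β :=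
    fun r => h3d z r
  have h3dW : BlockBd L W₁ (4 * β) := blockBd_rotClamp hL V₀ q hβq (by linarith)
  have ha'0 : 0 ≤ a' := by positivity
  -- `ṽ′(y)` is the flat one-step object of the rotated data
  have hid : vtilG L V₀ v' v₁ q = savg L (W' * W₁) q * (savg L W₁ q)⁻¹ := by
    rw [vtilG_apply, R0avg_eq_savg_rotClamp hL, R0avg_eq_savg_rotClamp hL, rotClamp_mul]
  have hid' : vtil L W' W₁ z = savg L (W' * W₁) q * (savg L W₁ q)⁻¹ := rfl
  -- the main term: `log R(w(x))v′(x) = R(V₀(Γ_{y,x})) log v′(x)`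
  have hval : ∀ r : Fin d → Fin L, W' (q + boxVec L r) = Rc (hol V₀ q (treeWord (boxVec L r))) (v' (q + boxVec L r)) := by
    intro r
    rw [hW', rotClamp_block, hwdef]
    simp [axialFn]
  have hmain : bmean L (fun r => mlog ((W' (q + boxVec L r) : 𝔸ˣ) : 𝔸)) =
      rlam L V₀ (fun x => mlog ((v' x : 𝔸ˣ) : 𝔸)) q := by
    simp only [rlam, hval, val_Rc_eq_cj, mlog_cj]
  have key := eq211_flat hL h4aW h4bW h3cW h3dW hα₄0 hα₄ ha'0 hs hα₃ (by linarith) z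
  rw [hid, ← hid', ← hmain]
  exact key

end OneStep

/-! ## §3 (212)–(214): the `j`-fold linear operator `Q′_j` and the remainder `C′_j` at a general background -/

section Levels

variable {𝔸 : Type*} [NormedRing 𝔸] [NormOneClass 𝔸] [NormedAlgebra ℂ 𝔸] [CompleteSpace 𝔸]

/-- **The linear operator `(Q′_jλ)(y) = Σ_{x∈Bʲ(y)} L^{−jd}R(U₀(Γ^{(j)}_{y,x}))λ(x)`** of (212)/(213) at the background `U₀`, defined
inductively: `Q′₀λ = λ`, `(Q′_{j+1}λ)(z) = Σ_{x∈B(Lz)} L^{−d}R(Ū₀ʲ(Γ_{Lz,x}))(Q′_jλ)(x)` — the composed transports (77) p. 30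
"`R(U₀(Γ^{(j+1)}_{x_{j+1},x})) = … R̄ʲ_{0,x_{j+1}} ⋯ R̄_{0,x₂}·R_{0,x₁}`" built level by level from the averaged backgrounds `Ū₀ʲ =
B7Prop2Explicit.avgIter L U₀ j`, in the coarse coordinates of (80) (`B7Eq84Concrete.uavg`: the level-`(j+1)` site `z` has block corner
`Lz` on level `j`).  The linear part of `λ ↦ (1/i) log ũ′ʲ` (B8 p. 80: "a linear part of `(1/i) log(R̄₀uʲ)(y)` is equal to
`(Q′_j(U₀)λ)(y)`"; B9 (3.19)); over the abstract `Blocking` carrier it is `B7Eq78Linearization.QprimeIter`.  At `U₀ = 1`: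
`B7Eq214Flat.lamAvg` (`lamAvgG_one_left`). [cite: Balaban1985Averaging, (212)–(213) p.50, (77)–(80) p.30] -/
def lamAvgG (L : ℕ) (U₀ : Site d → Fin d → 𝔸ˣ) : ℕ → (Site d → 𝔸) → Site d → 𝔸
  | 0, f => f
  | j + 1, f => fun z => rlam L (avgIter L U₀ j) (lamAvgG L U₀ j f) ((L : ℤ) • z)

omit [NormOneClass 𝔸] in
/-- `lamAvgG_zero`: `Q′₀λ = λ`. [cite: Balaban1985Averaging, (212) p.50] -/
@[simp] theorem lamAvgG_zero (L : ℕ) (U₀ : Site d → Fin d → 𝔸ˣ) (f : Site d → 𝔸) : lamAvgG L U₀ 0 f = f := rfl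

omit [NormOneClass 𝔸] in
/-- `lamAvgG_succ`: `(Q′_{j+1}λ)(z) = Σ_{x∈B(Lz)} L^{−d}R(Ū₀ʲ(Γ_{Lz,x}))(Q′_jλ)(x)`. [cite: Balaban1985Averaging, (212) p.50, (77) p.30] -/
theorem lamAvgG_succ (L : ℕ) (U₀ : Site d → Fin d → 𝔸ˣ) (j : ℕ) (f : Site d → 𝔸) (z : Site d) :
    lamAvgG L U₀ (j + 1) f z = rlam L (avgIter L U₀ j) (lamAvgG L U₀ j f) ((L : ℤ) • z) := rfl

omit [NormOneClass 𝔸] in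
/-- `lamAvgG_one_left`: at the flat background `Q′_j` is the `j`-fold block mean `B7Eq214Flat.lamAvg`.
[cite: Balaban1985Averaging, (212) p.50] -/
theorem lamAvgG_one_left (L : ℕ) (f : Site d → 𝔸) :
    ∀ j : ℕ, lamAvgG L (1 : Site d → Fin d → 𝔸ˣ) j f = lamAvg L j f
  | 0 => rfl
  | j + 1 => by
    funext z
    rw [lamAvgG_succ, lamAvg_succ, lamAvgG_one_left L f j, avgIter_one, rlam_one_left]

/-- The explicit constant of (214) at a general background: `C′_gen = 8832(d+1)C₆`, `C₆ = C₅ + 1 = 2 + 256(d+1)`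
(`B7Prop10General.C6`). [cite: Balaban1985Averaging, (214) p.50] -/
def Cgen (d : ℕ) : ℝ := 8832 * ((d : ℝ) + 1) * C6 d

omit [NormOneClass 𝔸] [NormedAlgebra ℂ 𝔸] [CompleteSpace 𝔸] in
/-- `2 ≤ C₆`. [folklore] -/
private theorem two_le_C6 : (2 : ℝ) ≤ C6 d := by
  unfold C6; linarith [one_le_C5 (d := d)]

variable {L : ℕ} {U₀ : Site d → Fin d → 𝔸ˣ} {k : ℕ} {u' u₁ : Site d → 𝔸ˣ} {α₀ α₃ α₄ η : ℝ}

/-- **(212) AT A GENERAL BACKGROUND, kernel form (sum version).**  Print (p. 50): "By (179) the function `Q′_j(u₁, λ)` is a composition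
of one-step functions and from the above formula we can easily see that `Q′_j(u₁, λ, y) = Σ_{x∈Bʲ(y)} L^{−jd}R(U₀(Γ^{(j)}_{y,x}))λ(x) +
Σ_{l=0}^{j−1} O(C₅α₄2α₄Lˡη + α₃2α₄(Lˡη)² + 4α₄²(Lˡη)²)`, (212)" — `Q′_j(u₁, λ) = (1/i) log ũ′ʲ` (208), `λ = (1/i) log u′`.
HERE, under the hypotheses of `B7Prop10General.prop10_general` — the DISPLAYED level hypotheses `Ū₀ʲ ∈ U1` and `‖Ū₀ʲ(∂p) − 1‖ ≤
2α₀(Lʲη)²` (`j < k`; p. 49 "`α₀` replaced by `2α₀(Lʲη)²`"; discharged from (52) in `eq214_general_of52`), (176) `SiteBd u′ α₄`, (177)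
`CovBondBd U₀ u′ (α₄η)`, (166)–(167) `u₁ ∈ Λ_k(U₀, α₃)` (`B7Eq167Flat.InLambda`), `L ≥ 2`, `0 ≤ η`, `Lᵏη ≤ 1`, and the explicit smallness
`0 ≤ α₃ ≤ 1/200`, `0 ≤ α₄`, `50C₆α₄ ≤ 1`, `3·10³(d+1)Lα₄ ≤ 1`, `C₄(α₀ + α₃ + α₄) ≤ 1` (`C₄ = B7Prop10General.C4G d L`), `0 ≤ α₀`,
`1024(d+1)(d+4)L²α₀ ≤ 1`, `32(d+1)²C₆L²α₀ ≤ 1`, `16dC′₅C₆L²α₀ ≤ 1`, `8dC₆Lα₀ ≤ 1` —: for every `j ≤ k` and every `z`,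
`‖log ũ′ʲ(z) − (Q′_jλ)(z)‖ ≤ 4416(d+1)C₆(α₃α₄ + α₄²)·Σ_{l<j} L^{l+1}η` (`ũ′ʲ = B7Prop10General.utilG L U₀ u′ u₁ j`, `Q′_jλ =
lamAvgG L U₀ j λ`, `λ = log u′`).  PROOF = print's induction over the levels: the step is `eq211_general` at the background `Ū₀ʲ` for
`v′ = ũ′ʲ`, `v₁ = ū₁ʲ` (`utilG_succ`) with the level constants of `prop10_general` ((204) `≤ C₆α₄` in the `α₄`-slot, (203) `≤ 2α₄Lʲη` in
the `α′₄`-slot, (167) `α₃L^{j+1}η` in the `β`-slot, `2α₀(Lʲη)²` in the `α₀`-slot; `a′ ≤ 3α₄Lʲη` by `8dC₆Lα₀ ≤ 1`), and the rotated block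
mean does not increase the sup norm of the accumulated error (`norm_rlam_le`).  At `U₀ = 1`: `B7Eq214Flat.eq212_flat` up to the
constants. [cite: Balaban1985Averaging, (212) p.50, (179) p.45, (203)–(204) p.49] -/
theorem eq212_general (hL : 2 ≤ L)
    (hV : ∀ j < k, ∀ (x : Site d) (κ : Fin d), avgIter L U₀ j x κ ∈ U1 𝔸)
    (h52 : ∀ j < k, ∀ (x : Site d) (κ μ : Fin d), κ ≠ μ →
      ‖((hol (avgIter L U₀ j) x (plaqWord κ μ) : 𝔸ˣ) : 𝔸) - 1‖ ≤ 2 * α₀ * ((L : ℝ) ^ j * η) ^ 2)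
    (h176 : SiteBd u' α₄) (h177 : CovBondBd U₀ u' (α₄ * η)) (hu₁ : InLambda L U₀ u₁ k α₃ η)
    (hη : 0 ≤ η) (hk : (L : ℝ) ^ k * η ≤ 1) (hα₀ : 0 ≤ α₀) (hα₃ : 0 ≤ α₃) (hα₃' : α₃ ≤ 1 / 200) (hα₄ : 0 ≤ α₄)
    (hs₁ : 50 * C6 d * α₄ ≤ 1) (hs₂ : 3000 * ((d : ℝ) + 1) * L * α₄ ≤ 1) (hs₃ : C4G d L * (α₀ + α₃ + α₄) ≤ 1)
    (hs₄ : 1024 * ((d : ℝ) + 1) * ((d : ℝ) + 4) * L ^ 2 * α₀ ≤ 1) (hs₅ : 32 * ((d : ℝ) + 1) ^ 2 * C6 d * L ^ 2 * α₀ ≤ 1)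
    (hs₆ : 16 * d * C5' d * C6 d * (L : ℝ) ^ 2 * α₀ ≤ 1) (hs₇ : 8 * d * C6 d * L * α₀ ≤ 1) :
    ∀ j ≤ k, ∀ z : Site d,
      ‖mlog ((utilG L U₀ u' u₁ j z : 𝔸ˣ) : 𝔸) - lamAvgG L U₀ j (fun x => mlog ((u' x : 𝔸ˣ) : 𝔸)) z‖
        ≤ 4416 * ((d : ℝ) + 1) * C6 d * (α₃ * α₄ + α₄ ^ 2) * ∑ i ∈ range j, (L : ℝ) ^ (i + 1) * η := by
  have hL1 : 1 ≤ L := le_trans (by norm_num) hL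
  have hLr : (2 : ℝ) ≤ L := by exact_mod_cast hL
  have hd : (0 : ℝ) ≤ d := Nat.cast_nonneg d
  have hC6 := two_le_C6 (d := d)
  have hs₁' : 10 * C6 d * α₄ ≤ 1 := by
    have h0 : 0 ≤ C6 d * α₄ := by positivity
    linarith
  have hα₃50 : α₃ ≤ 1 / 50 := hα₃'.trans (by norm_num)
  have hP10 := prop10_general hL hV h52 h176 h177 hu₁ hη hk hα₀ hα₃ hα₃50 hα₄ hs₁' hs₂ hs₃ hs₄ hs₅ hs₆
  set K : ℝ := 4416 * ((d : ℝ) + 1) * C6 d * (α₃ * α₄ + α₄ ^ 2) with hK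
  have hK0 : 0 ≤ K := by rw [hK]; positivity
  intro j
  induction j with
  | zero =>
    intro _ z
    simp
  | succ j ih =>
    intro hjk z
    have hjlt : j < k := Nat.lt_of_succ_le hjk
    have hIH := ih hjlt.le
    obtain ⟨hB, hS⟩ := hP10 j hjlt.le
    -- scale parameters `t = Lʲη`, `u = L^{j+1}η = Lt`
    obtain ⟨ht1, -⟩ := pow_eta_le hL1 hη hk hjlt.le
    obtain ⟨hu1, -⟩ := pow_eta_le hL1 hη hk (Nat.succ_le_of_lt hjlt)
    set t : ℝ := (L : ℝ) ^ j * η with ht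
    set u : ℝ := (L : ℝ) ^ (j + 1) * η with hu
    have ht0 : 0 ≤ t := by positivity
    have hu' : u = (L : ℝ) * t := by rw [hu, ht, pow_succ]; ring
    have hu0 : 0 ≤ u := by positivity
    have ht2 : t ^ 2 ≤ t := by rw [sq]; exact mul_le_of_le_one_left ht0 ht1
    -- level constants: (204) ≤ C₆α₄, (203) ≤ 2α₄t
    have h204 : rhs204G d L j α₀ α₄ η ≤ C6 d * α₄ := rhs204G_le hL hα₀ hα₄ hη ht1 hs₆
    have h203 : rhs203G d L j α₀ α₃ α₄ η ≤ 2 * α₄ * t := rhs203G_le hα₄ hη ht1 hs₃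
    -- the data of the one step at level `j`: background `Ū₀ʲ`, `v′ = ũ′ʲ`, `v₁ = ū₁ʲ`
    have hVj : ∀ (x : Site d) (κ : Fin d), avgIter L U₀ j x κ ∈ U1 𝔸 := hV j hjlt
    have h44 : ∀ (x : Site d) (κ μ : Fin d), κ ≠ μ →
        ‖((hol (avgIter L U₀ j) x (plaqWord κ μ) : 𝔸ˣ) : 𝔸) - 1‖ ≤ 2 * α₀ * t ^ 2 :=
      fun x κ μ hκμ => h52 j hjlt x κ μ hκμ
    have h4a : SiteBd (utilG L U₀ u' u₁ j) (C6 d * α₄) := siteBd_mono hS h204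
    have h4b : CovBondBd (avgIter L U₀ j) (utilG L U₀ u' u₁ j) (2 * α₄ * t) := covBondBd_mono hB h203
    have h3c : SiteBd (uavg L U₀ u₁ j) α₃ := fun x => hu₁.1 j hjlt.le x
    have h3d : CovBlockBd L (avgIter L U₀ j) (uavg L U₀ u₁ j) (α₃ * u) := by
      intro z' r
      have h := hu₁.2 j hjlt z' r
      rw [R0fun_add]
      calc _ ≤ α₃ * (L : ℝ) ^ (j + 1) * η := h
        _ = α₃ * u := by rw [hu]; ring
    -- smallness of the one step
    have hα₄j : C6 d * α₄ ≤ 1 / 50 := by linarith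
    have hβ : 200 * (α₃ * u) ≤ 1 := by
      have h1 : α₃ * u ≤ α₃ := mul_le_of_le_one_right hα₃ hu1
      linarith
    have hα₀j : 0 ≤ 2 * α₀ * t ^ 2 := by positivity
    have ha' : 2 * α₄ * t + 4 * (d * L * (2 * α₀ * t ^ 2)) * (C6 d * α₄) ≤ 3 * α₄ * t := by
      have e : 4 * (d * L * (2 * α₀ * t ^ 2)) * (C6 d * α₄) = (8 * d * C6 d * L * α₀) * (α₄ * t ^ 2) := by ring
      have h1 : (8 * d * C6 d * L * α₀) * (α₄ * t ^ 2) ≤ 1 * (α₄ * t ^ 2) :=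
        mul_le_mul_of_nonneg_right hs₇ (by positivity)
      have h2 : α₄ * t ^ 2 ≤ α₄ * t := mul_le_mul_of_nonneg_left ht2 hα₄
      rw [e]; linarith
    have ha'0 : 0 ≤ 2 * α₄ * t + 4 * (d * L * (2 * α₀ * t ^ 2)) * (C6 d * α₄) := by positivity
    have hs : 1000 * ((d : ℝ) + 1) * L * (2 * α₄ * t + 4 * (d * L * (2 * α₀ * t ^ 2)) * (C6 d * α₄)) ≤ 1 := by
      have h0 : 0 ≤ 1000 * ((d : ℝ) + 1) * L := by positivity
      have h1 := mul_le_mul_of_nonneg_left ha' h0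
      have h2 : 1000 * ((d : ℝ) + 1) * L * (3 * α₄ * t) = (3000 * ((d : ℝ) + 1) * L * α₄) * t := by ring
      have h3 : (3000 * ((d : ℝ) + 1) * L * α₄) * t ≤ 1 * 1 := mul_le_mul hs₂ ht1 ht0 (by norm_num)
      linarith
    -- the one step (211) at level `j`
    have hstep := eq211_general hL1 hVj hα₀j h44 h4a h4b h3c h3d hα₄j (by positivity) (hα₃'.trans (by norm_num)) hβ hs z
    -- its error is `≤ K·u`
    have herr : 448 * ((d : ℝ) + 1) * L * (C6 d * α₄) * (2 * α₄ * t + 4 * (d * L * (2 * α₀ * t ^ 2)) * (C6 d * α₄)) +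
        368 * ((d : ℝ) + 1) * L * (2 * α₄ * t + 4 * (d * L * (2 * α₀ * t ^ 2)) * (C6 d * α₄)) * (4 * (α₃ * u)) ≤ K * u := by
      have c1 : 0 ≤ 448 * ((d : ℝ) + 1) * L * (C6 d * α₄) := by positivity
      have c2 : 0 ≤ 368 * ((d : ℝ) + 1) * L := by positivity
      have c3 : 0 ≤ 4 * (α₃ * u) := by positivity
      have e1 : 448 * ((d : ℝ) + 1) * L * (C6 d * α₄) * (2 * α₄ * t + 4 * (d * L * (2 * α₀ * t ^ 2)) * (C6 d * α₄)) ≤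
          448 * ((d : ℝ) + 1) * L * (C6 d * α₄) * (3 * α₄ * t) := mul_le_mul_of_nonneg_left ha' c1
      have e2 : 368 * ((d : ℝ) + 1) * L * (2 * α₄ * t + 4 * (d * L * (2 * α₀ * t ^ 2)) * (C6 d * α₄)) * (4 * (α₃ * u)) ≤
          368 * ((d : ℝ) + 1) * L * (3 * α₄ * t) * (4 * (α₃ * u)) :=
        mul_le_mul_of_nonneg_right (mul_le_mul_of_nonneg_left ha' c2) c3
      have e3 : 448 * ((d : ℝ) + 1) * L * (C6 d * α₄) * (3 * α₄ * t) = 1344 * ((d : ℝ) + 1) * C6 d * α₄ ^ 2 * u := by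
        rw [hu']; ring
      have e4 : 368 * ((d : ℝ) + 1) * L * (3 * α₄ * t) * (4 * (α₃ * u)) = 4416 * ((d : ℝ) + 1) * (α₃ * α₄) * (u * u) := by
        rw [hu']; ring
      have e5 : u * u ≤ u := mul_le_of_le_one_left hu0 hu1
      have e6 : 4416 * ((d : ℝ) + 1) * (α₃ * α₄) * (u * u) ≤ 4416 * ((d : ℝ) + 1) * (α₃ * α₄) * u :=
        mul_le_mul_of_nonneg_left e5 (by positivity)
      have e7 : 4416 * ((d : ℝ) + 1) * (α₃ * α₄) * u ≤ 4416 * ((d : ℝ) + 1) * C6 d * (α₃ * α₄) * u := by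
        have h0 : 0 ≤ 4416 * ((d : ℝ) + 1) * (α₃ * α₄) * u := by positivity
        have h1 : 4416 * ((d : ℝ) + 1) * (α₃ * α₄) * u * 1 ≤ 4416 * ((d : ℝ) + 1) * (α₃ * α₄) * u * C6 d :=
          mul_le_mul_of_nonneg_left (by linarith) h0
        have h2 : 4416 * ((d : ℝ) + 1) * (α₃ * α₄) * u * C6 d = 4416 * ((d : ℝ) + 1) * C6 d * (α₃ * α₄) * u := by ring
        linarith
      have e8 : 1344 * ((d : ℝ) + 1) * C6 d * α₄ ^ 2 * u ≤ 4416 * ((d : ℝ) + 1) * C6 d * α₄ ^ 2 * u := by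
        have h0 : 0 ≤ ((d : ℝ) + 1) * C6 d * α₄ ^ 2 * u := by positivity
        linarith
      have e9 : 4416 * ((d : ℝ) + 1) * C6 d * α₄ ^ 2 * u + 4416 * ((d : ℝ) + 1) * C6 d * (α₃ * α₄) * u = K * u := by
        rw [hK]; ring
      linarith
    -- assemble: `D_{j+1}(z) = [one step] + Q′(D_j)`
    have eU : utilG L U₀ u' u₁ (j + 1) z =
        vtilG L (avgIter L U₀ j) (utilG L U₀ u' u₁ j) (uavg L U₀ u₁ j) ((L : ℤ) • z) := by
      rw [utilG_succ]
    rw [eU, lamAvgG_succ]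
    have hDj : ‖rlam L (avgIter L U₀ j) (fun x => mlog ((utilG L U₀ u' u₁ j x : 𝔸ˣ) : 𝔸)) ((L : ℤ) • z) -
        rlam L (avgIter L U₀ j) (lamAvgG L U₀ j (fun x => mlog ((u' x : 𝔸ˣ) : 𝔸))) ((L : ℤ) • z)‖
          ≤ K * ∑ i ∈ range j, (L : ℝ) ^ (i + 1) * η := by
      rw [rlam_sub]
      exact norm_rlam_le hL1 hVj (fun x => hIH x) _
    calc _ ≤ ‖mlog ((vtilG L (avgIter L U₀ j) (utilG L U₀ u' u₁ j) (uavg L U₀ u₁ j) ((L : ℤ) • z) : 𝔸ˣ) : 𝔸) -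
            rlam L (avgIter L U₀ j) (fun x => mlog ((utilG L U₀ u' u₁ j x : 𝔸ˣ) : 𝔸)) ((L : ℤ) • z)‖ +
          ‖rlam L (avgIter L U₀ j) (fun x => mlog ((utilG L U₀ u' u₁ j x : 𝔸ˣ) : 𝔸)) ((L : ℤ) • z) -
            rlam L (avgIter L U₀ j) (lamAvgG L U₀ j (fun x => mlog ((u' x : 𝔸ˣ) : 𝔸))) ((L : ℤ) • z)‖ :=
          norm_sub_le_norm_sub_add_norm_sub _ _ _
      _ ≤ K * u + K * ∑ i ∈ range j, (L : ℝ) ^ (i + 1) * η := add_le_add (hstep.trans herr) hDj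
      _ = K * ∑ i ∈ range (j + 1), (L : ℝ) ^ (i + 1) * η := by rw [sum_range_succ, hu]; ring

/-- **(213)–(214) AT A GENERAL BACKGROUND, kernel form.**  Print (p. 50): "`Q′_j(u₁, λ, y) = (Q′_jλ)(y) + C′_j(u₁, λ, y)`, (213)
`|C′_j(u₁, λ, y)| = O((α₃α₄ + α₄²)Lʲη)`. (214)" — under the hypotheses of `eq212_general` (= those of
`B7Prop10General.prop10_general` plus `α₃ ≤ 1/200`, `50C₆α₄ ≤ 1`, `8dC₆Lα₀ ≤ 1`): for all `j ≤ k` and all `y`, the remainder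
`C′_j(u₁, λ, y) := log ũ′ʲ(y) − (Q′_jλ)(y)` satisfies `‖C′_j(u₁, λ, y)‖ ≤ C′_gen·(α₃α₄ + α₄²)·Lʲη` with the explicit `C′_gen = Cgen d =
8832(d+1)C₆` (depending on `d` only — print's shape `O((α₃α₄ + α₄²)Lʲη)` exactly) — from `eq212_general` and `Σ_{l<j} L^{l+1}η ≤ 2Lʲη`
(`L ≥ 2`, `B7.sum_pow_succ_le`; the level bookkeeping (212) ⇒ (214) in print's letters is `B7Eq214.ineq214_of_212`).  The abstract-carrier
citation statement is `B7Eq214.Eq214Printed`; at `U₀ = 1` this is `B7Eq214Flat.eq214_flat` up to the constants (`utilG_one_left`,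
`lamAvgG_one_left`, `avgIter_one`). [cite: Balaban1985Averaging, (213)–(214) p.50] -/
theorem eq214_general (hL : 2 ≤ L)
    (hV : ∀ j < k, ∀ (x : Site d) (κ : Fin d), avgIter L U₀ j x κ ∈ U1 𝔸)
    (h52 : ∀ j < k, ∀ (x : Site d) (κ μ : Fin d), κ ≠ μ →
      ‖((hol (avgIter L U₀ j) x (plaqWord κ μ) : 𝔸ˣ) : 𝔸) - 1‖ ≤ 2 * α₀ * ((L : ℝ) ^ j * η) ^ 2)
    (h176 : SiteBd u' α₄) (h177 : CovBondBd U₀ u' (α₄ * η)) (hu₁ : InLambda L U₀ u₁ k α₃ η)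
    (hη : 0 ≤ η) (hk : (L : ℝ) ^ k * η ≤ 1) (hα₀ : 0 ≤ α₀) (hα₃ : 0 ≤ α₃) (hα₃' : α₃ ≤ 1 / 200) (hα₄ : 0 ≤ α₄)
    (hs₁ : 50 * C6 d * α₄ ≤ 1) (hs₂ : 3000 * ((d : ℝ) + 1) * L * α₄ ≤ 1) (hs₃ : C4G d L * (α₀ + α₃ + α₄) ≤ 1)
    (hs₄ : 1024 * ((d : ℝ) + 1) * ((d : ℝ) + 4) * L ^ 2 * α₀ ≤ 1) (hs₅ : 32 * ((d : ℝ) + 1) ^ 2 * C6 d * L ^ 2 * α₀ ≤ 1)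
    (hs₆ : 16 * d * C5' d * C6 d * (L : ℝ) ^ 2 * α₀ ≤ 1) (hs₇ : 8 * d * C6 d * L * α₀ ≤ 1) :
    ∀ j ≤ k, ∀ z : Site d,
      ‖mlog ((utilG L U₀ u' u₁ j z : 𝔸ˣ) : 𝔸) - lamAvgG L U₀ j (fun x => mlog ((u' x : 𝔸ˣ) : 𝔸)) z‖
        ≤ Cgen d * (α₃ * α₄ + α₄ ^ 2) * ((L : ℝ) ^ j * η) := by
  intro j hj z
  have hLr : (2 : ℝ) ≤ L := by exact_mod_cast hL
  have h := eq212_general hL hV h52 h176 h177 hu₁ hη hk hα₀ hα₃ hα₃' hα₄ hs₁ hs₂ hs₃ hs₄ hs₅ hs₆ hs₇ j hj z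
  have hs := B7.sum_pow_succ_le (L : ℝ) η hLr hη j
  have h0 : 0 ≤ 4416 * ((d : ℝ) + 1) * C6 d * (α₃ * α₄ + α₄ ^ 2) := by
    have := two_le_C6 (d := d); positivity
  calc _ ≤ _ := h
    _ ≤ 4416 * ((d : ℝ) + 1) * C6 d * (α₃ * α₄ + α₄ ^ 2) * (2 * ((L : ℝ) ^ j * η)) :=
        mul_le_mul_of_nonneg_left hs h0
    _ = Cgen d * (α₃ * α₄ + α₄ ^ 2) * ((L : ℝ) ^ j * η) := by rw [Cgen]; ring

/-- **(213)–(214) AT A GENERAL BACKGROUND UNDER (52)** — `eq214_general` with its level hypotheses DISCHARGED by Proposition 2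
(`B7Prop10General.levels_of52`: p. 49 "`α₀` replaced by `2α₀(Lʲη)²`", `η = L^{−k}`): for `U₀` with values in an average-closed
subgroup `G ⊂ U1` (`B7Prop2Explicit.AvgClosed`, e.g. `unitaryUnits 𝔸`) satisfying (52) `sup_p‖U₀(∂p) − 1‖ < α₀η²`, and `u′, u₁` with
(176), (177), (166)–(167): `‖log ũ′ʲ(y) − (Q′_jλ)(y)‖ ≤ C′_gen(α₃α₄ + α₄²)Lʲη` for all `j ≤ k`, `y`.  Smallness: that of
`eq214_general` plus Prop. 2's `C₀α₀ ≤ ⅓`, `2α₀ ≤ c′₂`. [cite: Balaban1985Averaging, (213)–(214) p.50, Proposition 2 p.26, Proposition 10 p.50] -/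
theorem eq214_general_of52 (hL : 2 ≤ L) {G : Subgroup 𝔸ˣ} (hG : AvgClosed d L G) (hU : ∀ x κ, U₀ x κ ∈ G)
    (hα : 0 < α₀) (hα3 : C0 d * α₀ ≤ 1 / 3) (hα2 : 2 * α₀ ≤ c2' d L)
    (h52 : pdev U₀ < α₀ * (((L : ℝ) ^ k)⁻¹) ^ 2)
    (h176 : SiteBd u' α₄) (h177 : CovBondBd U₀ u' (α₄ * ((L : ℝ) ^ k)⁻¹))
    (hu₁ : InLambda L U₀ u₁ k α₃ (((L : ℝ) ^ k)⁻¹))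
    (hα₃ : 0 ≤ α₃) (hα₃' : α₃ ≤ 1 / 200) (hα₄ : 0 ≤ α₄)
    (hs₁ : 50 * C6 d * α₄ ≤ 1) (hs₂ : 3000 * ((d : ℝ) + 1) * L * α₄ ≤ 1) (hs₃ : C4G d L * (α₀ + α₃ + α₄) ≤ 1)
    (hs₄ : 1024 * ((d : ℝ) + 1) * ((d : ℝ) + 4) * L ^ 2 * α₀ ≤ 1) (hs₅ : 32 * ((d : ℝ) + 1) ^ 2 * C6 d * L ^ 2 * α₀ ≤ 1)
    (hs₆ : 16 * d * C5' d * C6 d * (L : ℝ) ^ 2 * α₀ ≤ 1) (hs₇ : 8 * d * C6 d * L * α₀ ≤ 1) :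
    ∀ j ≤ k, ∀ z : Site d,
      ‖mlog ((utilG L U₀ u' u₁ j z : 𝔸ˣ) : 𝔸) - lamAvgG L U₀ j (fun x => mlog ((u' x : 𝔸ˣ) : 𝔸)) z‖
        ≤ Cgen d * (α₃ * α₄ + α₄ ^ 2) * ((L : ℝ) ^ j * ((L : ℝ) ^ k)⁻¹) := by
  obtain ⟨hV, hP⟩ := levels_of52 hL hG hU k hα hα3 hα2 h52
  have hη : (0 : ℝ) ≤ ((L : ℝ) ^ k)⁻¹ := by positivity
  have hk : (L : ℝ) ^ k * ((L : ℝ) ^ k)⁻¹ ≤ 1 := by rw [mul_inv_cancel₀ (by positivity)]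
  exact eq214_general hL (fun j hj => hV j hj.le) (fun j hj => hP j hj.le) h176 h177 hu₁ hη hk hα.le hα₃ hα₃' hα₄
    hs₁ hs₂ hs₃ hs₄ hs₅ hs₆ hs₇

/-- **(207) ⇒ (213)–(214) AT A GENERAL BACKGROUND, in print's datum `λ`.**  Print (p. 50): "The assumptions (176), (177) can
be reformulated in terms of the functions `λ = (1/i) log u′`. If we assume `|(D^η_{U₀}λ)(b)| < α₄, |λ(x)| < α₄, λ(x) ∈ 𝔤ᶜ, α₄`
sufficiently small, (207) then assumptions (176), (177) are satisfied with a constant `4α₄` instead of `α₄`. … hence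
`Q′_j(u₁, λ, y) = (Q′_jλ)(y) + C′_j(u₁, λ, y)`, (213) `|C′_j(u₁, λ, y)| = O((α₃α₄ + α₄²)Lʲη)`. (214)"  HERE: `U₀` with values in
an average-closed subgroup `G ⊂ U1` satisfying (52) `sup_p‖U₀(∂p) − 1‖ < α₀η²`, `η = L^{−k}`; the datum `λ : ℤᵈ → 𝔸` with (207)
`‖R(U_{0,b})λ(b₊) − λ(b₋)‖ < α₄η` (`= η|(D^η_{U₀}λ)(b)|`, the covariant `η`-lattice derivative, (56) `R(X)Y = XYX⁻¹`) and
`‖λ(x)‖ < α₄`; `u′ := e^{λ}`; `u₁ ∈ Λ_k(U₀, α₃)` ((166)–(167)); smallness = that of `eq214_general_of52` at `α₄ ↦ 4α₄`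
(`200C₆α₄ ≤ 1`, `12·10³(d+1)Lα₄ ≤ 1`, `C₄(α₀ + α₃ + 4α₄) ≤ 1`, the `α₀`-conditions unchanged).  THEN for all `j ≤ k`, `z`:
`‖log ũ′ʲ(z) − (Q′_jλ)(z)‖ ≤ 16C′_gen·(α₃α₄ + α₄²)·Lʲη` — (213) with `C′_j(u₁, λ, ·) := log ũ′ʲ − Q′_jλ` and (214) explicit.
PROOF = print's: (207) ⇒ (176)/(177) with `4α₄` is `B7Eq214.ineq176_of_207` / `ineq177_of_207` (the latter for the bond
expression `e^{−λ(b₋)}R(U_{0,b})e^{λ(b₊)}` of `CovBondBd`), then `eq214_general_of52` at `α₄ ↦ 4α₄` and `log e^{λ(x)} = λ(x)`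
(`B7Eq170Flat.mlog_exp_of_le`).  At `U₀ = 1`: `B7Eq214FlatQprime.eq214_flat_of_207` (p22) up to the constants.
[cite: Balaban1985Averaging, (207) + (213)–(214) p.50] -/
theorem eq214_general_of207 (hL : 2 ≤ L) {G : Subgroup 𝔸ˣ} (hG : AvgClosed d L G) (hU : ∀ x κ, U₀ x κ ∈ G)
    (hα : 0 < α₀) (hα3 : C0 d * α₀ ≤ 1 / 3) (hα2 : 2 * α₀ ≤ c2' d L)
    (h52 : pdev U₀ < α₀ * (((L : ℝ) ^ k)⁻¹) ^ 2)
    {lam : Site d → 𝔸}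
    (h207a : ∀ (x : Site d) (κ : Fin d), ‖cj (U₀ x κ) (lam (x + e κ)) - lam x‖ < α₄ * ((L : ℝ) ^ k)⁻¹)
    (h207b : ∀ x : Site d, ‖lam x‖ < α₄)
    (hu₁ : InLambda L U₀ u₁ k α₃ (((L : ℝ) ^ k)⁻¹))
    (hα₃ : 0 ≤ α₃) (hα₃' : α₃ ≤ 1 / 200)
    (hs₁ : 200 * C6 d * α₄ ≤ 1) (hs₂ : 12000 * ((d : ℝ) + 1) * L * α₄ ≤ 1) (hs₃ : C4G d L * (α₀ + α₃ + 4 * α₄) ≤ 1)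
    (hs₄ : 1024 * ((d : ℝ) + 1) * ((d : ℝ) + 4) * L ^ 2 * α₀ ≤ 1) (hs₅ : 32 * ((d : ℝ) + 1) ^ 2 * C6 d * L ^ 2 * α₀ ≤ 1)
    (hs₆ : 16 * d * C5' d * C6 d * (L : ℝ) ^ 2 * α₀ ≤ 1) (hs₇ : 8 * d * C6 d * L * α₀ ≤ 1) :
    ∀ j ≤ k, ∀ z : Site d,
      ‖mlog ((utilG L U₀ (fun x => expUnit (lam x)) u₁ j z : 𝔸ˣ) : 𝔸) - lamAvgG L U₀ j lam z‖
        ≤ 16 * Cgen d * (α₃ * α₄ + α₄ ^ 2) * ((L : ℝ) ^ j * ((L : ℝ) ^ k)⁻¹) := by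
  have hL1 : 1 ≤ L := le_trans (by norm_num) hL
  have hLr : (1 : ℝ) ≤ L := by exact_mod_cast hL1
  have hC6 := two_le_C6 (d := d)
  have hα₄0 : 0 ≤ α₄ := le_of_lt (lt_of_le_of_lt (norm_nonneg _) (h207b 0))
  have hα₄s : α₄ ≤ 1 / 400 := by
    have h1 : 2 * α₄ ≤ C6 d * α₄ := mul_le_mul_of_nonneg_right hC6 hα₄0
    linarith
  have hα₄' : α₄ ≤ 1 / 4 := hα₄s.trans (by norm_num)
  have hη1 : ((L : ℝ) ^ k)⁻¹ ≤ 1 := inv_le_one_of_one_le₀ (one_le_pow₀ hLr)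
  -- (207) ⇒ (176), (177) with the constant `4α₄`
  have h176 : SiteBd (fun x => expUnit (lam x)) (4 * α₄) := fun x => by
    show ‖((expUnit (lam x) : 𝔸ˣ) : 𝔸) - 1‖ ≤ 4 * α₄
    rw [val_expUnit]
    exact (B7Eq214.ineq176_of_207 (lam x) hα₄' (h207b x)).le
  have h177 : CovBondBd U₀ (fun x => expUnit (lam x)) (4 * α₄ * ((L : ℝ) ^ k)⁻¹) := fun x κ => by
    show ‖((((expUnit (lam x))⁻¹ * Rc (U₀ x κ) (expUnit (lam (x + e κ))) : 𝔸ˣ)) : 𝔸) - 1‖ ≤ 4 * α₄ * ((L : ℝ) ^ k)⁻¹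
    rw [Units.val_mul, val_inv_expUnit, val_Rc_eq_cj, val_expUnit, cj_apply]
    exact (B7Eq214.ineq177_of_207 (U₀ x κ) (lam x) (lam (x + e κ)) hα₄' hη1 (h207b x) (h207a x κ)).le
  -- `log e^{λ} = λ`
  have hlog : (fun x => mlog ((((fun x => expUnit (lam x)) x : 𝔸ˣ)) : 𝔸)) = lam :=
    funext fun x => by rw [val_expUnit, mlog_exp_of_le ((h207b x).le.trans (hα₄s.trans (by norm_num)))]
  have hs₁' : 50 * C6 d * (4 * α₄) ≤ 1 := by linarith
  have hs₂' : 3000 * ((d : ℝ) + 1) * L * (4 * α₄) ≤ 1 := by linarith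
  have h := eq214_general_of52 hL hG hU hα hα3 hα2 h52 h176 h177 hu₁ hα₃ hα₃' (by positivity) hs₁' hs₂' hs₃ hs₄ hs₅
    hs₆ hs₇
  intro j hj z
  have hjz := h j hj z
  rw [hlog] at hjz
  refine hjz.trans ?_
  have hCg : 0 ≤ Cgen d := by unfold Cgen; positivity
  have ht : 0 ≤ (L : ℝ) ^ j * ((L : ℝ) ^ k)⁻¹ := by positivity
  have hβ : α₃ * (4 * α₄) + (4 * α₄) ^ 2 ≤ 16 * (α₃ * α₄ + α₄ ^ 2) := by nlinarith [mul_nonneg hα₃ hα₄0]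
  calc Cgen d * (α₃ * (4 * α₄) + (4 * α₄) ^ 2) * ((L : ℝ) ^ j * ((L : ℝ) ^ k)⁻¹)
      ≤ Cgen d * (16 * (α₃ * α₄ + α₄ ^ 2)) * ((L : ℝ) ^ j * ((L : ℝ) ^ k)⁻¹) := by gcongr
    _ = 16 * Cgen d * (α₃ * α₄ + α₄ ^ 2) * ((L : ℝ) ^ j * ((L : ℝ) ^ k)⁻¹) := by ring

end Levels

end Literature.MathematicalPhysics.QuantumFieldTheory.Balaban1983to89.B7Eq214General
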